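import Summits.CriticalPhenomena.PercolationContinuityZ3.Theorems.Transplant.SkelPhiNegReachCorridor1
import Summits.CriticalPhenomena.PercolationContinuityZ3.Theorems.Transplant.SkelPhiNegReachRoomsB
import Summits.CriticalPhenomena.PercolationContinuityZ3.Theorems.Transplant.SkelPhiNegReachTargets
import Summits.CriticalPhenomena.PercolationContinuityZ3.Theorems.Transplant.SkelPhiNegReachDeepB
import Summits.CriticalPhenomena.PercolationContinuityZ3.Theorems.Transplant.SkelPhiNegReachExcessB
import Summits.CriticalPhenomena.PercolationContinuityZ3.Theorems.Transplant.SkelPhiNegRealisedG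
import Summits.CriticalPhenomena.PercolationContinuityZ3.Theorems.Transplant.SkelPhiParaVLocDChain
import Summits.CriticalPhenomena.PercolationContinuityZ3.Theorems.Transplant.SkelPhiConcReachRun
import HarnessLib

/-!
# N1 (the `{±1}` node), (C) column file (C-A7-b), RULING B.15 (S1, SMALL ARRIVAL BOX): `Skel.ReachOblRHN` FOR THE TWIN SCHEME OF RECORD, RUN FORM —
# the ∀-assembly over run histories of `⟨cellGeomSG₂b G F P t (concRadii2N P gap gap' E₀ L' off) b₀, q, δc⟩` (hp-8's small-box twin, p292701; arrival
# boxes `cen ± b₀`, `b₀ ≤ 3r`) from the ONE-FRAME corridor per probe `(y, du)` in `R = runX φ (cOf α y) n h 1` (base = the column vertex, `F(cOf α y) =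
# cen y`): signed v-rounds `P_A` ⟶ u-rounds `P_B` ⟶ signed band `B du` (`reachOblAtHN_negCorridor1`, C-S6), the realised radii (`reach_radii_concN`,
# scheme-generic), deep entrances (`deep_of_run₂b`), the rim excess (`real_rim_le_concSG₂b`), the true targets (`coreTF_nonempty_of_mem`, `coreTF₂_nonempty`,
# `exists_mem_span_runX_eq`), the rooms from reading inequalities (`room_Q_union_Hfull_of_rd` for the three segments, `roomLb_of_rd` + `mem_Mb_of_mem_habΩ₂`
# for the last core at the SMALL box) — with the per-step KIT CLAUSES of the one frame as the hypotheses `hkitsR₁` (v-rounds) and `hkitsR₂` (u-rounds ⧺ band),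
# served by `hkits_vlocDHab/_locHab/_x|ybandHab` (C-S4).  Twin of C-A7 `reachOblRHN_negSG₂` (p288174) with segment 1 replaced (C-STEP0.md §4–§5).

builds on p205010 (kernel theorem, internal audit signed; external expert review pending) — nothing in this file uses p205010; nothing here is a
claim about the open node `SamePDropOfSkeletonNeg`.
Lane `prim-bschramm`, seat `prim-bschramm-p5` (gen 9; (C) lineage); helper file (`--supports stmt-CriticalPhenomena-4575`).

* `PCells2.Mb_eq_Icc`, **`Skelφ.reachOblRHN_negSG₂b`**.
[cite: KozmaNitzan2024, §4 Lemma 12 (pp. 23–25), p. 26 ((29)), p. 30 (Step IV), p. 31] [cite: MartineauTassion2017, §4.3 Lemma 4.2]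
-/

noncomputable section

open MeasureTheory

namespace Summit.CriticalPhenomena.PercolationContinuityZ3.Theorems

namespace Transplant

open Literature.Probability.LatticeModels in
/-- The small arrival box as a literal interval. [folklore] -/
theorem PCells2.Mb_eq_Icc (P : PCells2) (b₀ : Fin 2 → ℕ) (v : Site 2) :
    P.Mb b₀ v = Finset.Icc (P.cen v - fun i => ((b₀ i : ℕ) : ℤ)) (P.cen v + fun i => ((b₀ i : ℕ) : ℤ)) := by
  ext z
  rw [PCells2.mem_Mb_iff, Finset.mem_Icc, Pi.le_def, Pi.le_def]
  simp only [Pi.sub_apply, Pi.add_apply]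
  exact ⟨fun h => ⟨fun i => (h i).1, fun i => (h i).2⟩, fun h i => ⟨h.1 i, h.2 i⟩⟩

namespace Skelφ

open Literature.Probability.Percolation Literature.Probability.LatticeModels SimpleGraph GadgetSystem ProbeHistory HSiteScheme Contour KNCells
open KNCells.KSchA KNLevels ChainPlanar ChainPara
open Literature.Probability.Percolation.GM
open Literature.Probability.Percolation.KozmaNitzan.Cells (oth sgOf sgOf_sign stepVec_apply_fst stepVec_apply_oth)
open Literature.Barriers.CriticalPhenomena (graphBall graphBall_finite mem_graphBall_self graphBall_mono)
open BoxProdZ2 (ConcRadiiG nQ nS Erad Frad Erad_mono Frad_succ Frad_le_Erad Erad_add_gap_le_Frad_succ add_mul_le_Erad)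
open TwoAxis.Para (modulus)
open Skel (excess winGraphIn winGraphIn_le ReachOblAtHN ReachOblRHN l1_tgt_le_nQ)

open scoped Classical

variable {V : Type} [DecidableEq V] {G : SimpleGraph V} [G.LocallyFinite] {φ : V → Site 2}

/-- `oth 1 = 0` on `Fin 2`. [folklore] -/
private theorem oth_one_r : oth (1 : Fin 2) = 0 := by decide

/-- **`Skel.ReachOblRHN` FOR THE TWIN SCHEME OF RECORD (small arrival boxes) FROM THE ONE-FRAME CORRIDORS** (see the module docstring for the inputs;
the kit clauses of the two segments of the one frame are the last two hypotheses, stated after the `let`s).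
[cite: KozmaNitzan2024, §4 Lemma 12 (pp. 23–25), p. 30 (Step IV), p. 31] -/
theorem reachOblRHN_negSG₂b [Countable V] (hstep : Steps G φ) (hlipφ : Lip G φ) {t : V} {A : ℤ} (hA : 0 < A) {n : ℕ} (hn : 1 ≤ n)
    {h vα vβ : ℤ} (hm : 0 < modulus n h vα vβ) {c₀' c₁' s₀ s₁ D : ℤ} (hc₀' : 0 < c₀') (hc₁' : 0 < c₁') (hD : 0 < D)
    {kq : ℕ} (hκ : h.natAbs ≤ kq * n)
    (F : V → Site 2) (hFdef : F = fineSkel φ t A n h vα vβ c₀' c₁' s₀ s₁ D) (hlipF : Lip G F) (hws : WeakSteps G F) (hF0 : F t = 0)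
    (P : PCells2) (gap gap' : ℕ → ℕ) (E₀ L' : ℕ) (off : Site 2 → ℕ) (q : unitInterval) (δc : ℝ) (b₀ : Fin 2 → ℕ) (hb : ∀ i, b₀ i ≤ 3 * P.r i)
    (hΛ : WFS2 P (concRadii2N P gap gap' E₀ L' off)) (hgap : ∀ m, 20 * P.rmax ≤ gap m) {c : ℕ} (hgapc : ∀ m, c ≤ gap m)
    (hoff : ∀ x : Site 2, off x ≤ c * ((x 0).natAbs + (x 1).natAbs) + 1) (hE₀ : 3 ≤ E₀) (hgapL : ∀ ρ, L' ≤ gap ρ)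
    (hcol : ∀ a x, ∃ y ∈ VWin G F t (P.Q x) ((concRadii2N P gap gap' E₀ L' off).rQ a x), F y = P.cen x)
    -- the column vertices (bases of the run frames)
    (cOf : ℕ → Site 2 → V) (hcF : ∀ a y, F (cOf a y) = P.cen y)
    (hcQ : ∀ a y, cOf a y ∈ VWin G F t (P.Q y) ((concRadii2N P gap gap' E₀ L' off).rQ a y))
    {cC dC : ℕ} (hcD : ∀ a (y : Site 2), cOf a y ∈ graphBall G t (cC * ((y 0).natAbs + (y 1).natAbs) + dC)) (hgapC : ∀ m, cC ≤ gap m)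
    -- segment A: signed v-rounds; the arrival box `cen ± b₀` read into their start box
    (PA : LocPrmD) (hPA : LocOKD PA) (hdL : |PA.d| ≤ PA.Lb) {aW Bx bL : ℤ}
    (ha : D * (c₁' * (n : ℤ) * ((b₀ 0 : ℕ) + 1) + c₀' * |vα| * ((b₀ 1 : ℕ) + 1)) ≤ c₀' * c₁' * A * modulus n h vα vβ * aW)
    (hBx : D * (((b₀ 1 : ℕ) : ℤ) + 1) ≤ c₁' * A * Bx) (hb' : Bx / (shearUnit n h : ℤ) + 1 ≤ bL) (haW : aW ≤ PA.W) (hbL : bL ≤ PA.L0)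
    -- segments B and C: u-rounds, the signed band per direction, the joins
    (PB : LocPrm) (hPB : LocOK PB) (B : MDir → RunPrm) (hB : ∀ du, RunOK (B du)) (heb : ∀ du, (B du).eb = (B du).ea)
    (hR' : ∀ du, (B du).ea = PB.e)
    (hjoin : ∀ du, (PB.scheduleN 0 0 hPB).core (PB.N + 1) ⊆ ((B du).scheduleN du.1 (sgOf_sign du) 0 (hB du) (heb du)).core 0)
    (hreg : ∀ du, ((B du).scheduleN du.1 (sgOf_sign du) 0 (hB du) (heb du)).core 0 ⊆ (PB.scheduleN 0 0 hPB).region PB.N)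
    (hjoinA : (PA.scheduleN 1 0 hPA hdL).core (PA.N + 1) ⊆ (PB.scheduleN 0 0 hPB).core 0)
    -- the rooms as reading inequalities: segment A (axis `1`), segment B (axis `0`), the band, the last core (SMALL box)
    (hrdA : ∀ du : MDir, ∀ k ≤ PA.N,
      let lo := dLo 1 1 0 (-(PA.toLoc.L k + PA.e + PA.La)) (PA.toLoc.L k + PA.e + PA.La) (-(PA.Wk k + PA.e + PA.Lb)) (PA.Wk k + PA.e + PA.Lb)
      let hi := dHi 1 1 0 (-(PA.toLoc.L k + PA.e + PA.La)) (PA.toLoc.L k + PA.e + PA.La) (-(PA.Wk k + PA.e + PA.Lb)) (PA.Wk k + PA.e + PA.Lb)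
      (sgOf du = 1 → -(5 * (P.r du.1 : ℤ)) ≤ rdLo A n h vα vβ c₀' c₁' D lo hi du.1 ∧ rdHi A n h vα vβ c₀' c₁' D lo hi du.1 ≤ 22 * (P.r du.1 : ℤ)) ∧
      (sgOf du = -1 → -(5 * (P.r du.1 : ℤ)) ≤ -rdHi A n h vα vβ c₀' c₁' D lo hi du.1 ∧ -rdLo A n h vα vβ c₀' c₁' D lo hi du.1 ≤ 22 * (P.r du.1 : ℤ)) ∧
      (-(2 * (P.r (oth du.1) : ℤ)) ≤ rdLo A n h vα vβ c₀' c₁' D lo hi (oth du.1) ∧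
        rdHi A n h vα vβ c₀' c₁' D lo hi (oth du.1) ≤ 2 * (P.r (oth du.1) : ℤ)))
    (hrd₂ : ∀ du : MDir, ∀ k ≤ PB.N,
      let lo := dLo 0 1 0 (-(PB.L k + PB.e + PB.La)) (PB.L k + PB.e + PB.La) (-(PB.Wk k + PB.e + PB.Lb)) (PB.Wk k + PB.e + PB.Lb)
      let hi := dHi 0 1 0 (-(PB.L k + PB.e + PB.La)) (PB.L k + PB.e + PB.La) (-(PB.Wk k + PB.e + PB.Lb)) (PB.Wk k + PB.e + PB.Lb)
      (sgOf du = 1 → -(5 * (P.r du.1 : ℤ)) ≤ rdLo A n h vα vβ c₀' c₁' D lo hi du.1 ∧ rdHi A n h vα vβ c₀' c₁' D lo hi du.1 ≤ 22 * (P.r du.1 : ℤ)) ∧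
      (sgOf du = -1 → -(5 * (P.r du.1 : ℤ)) ≤ -rdHi A n h vα vβ c₀' c₁' D lo hi du.1 ∧ -rdLo A n h vα vβ c₀' c₁' D lo hi du.1 ≤ 22 * (P.r du.1 : ℤ)) ∧
      (-(2 * (P.r (oth du.1) : ℤ)) ≤ rdLo A n h vα vβ c₀' c₁' D lo hi (oth du.1) ∧
        rdHi A n h vα vβ c₀' c₁' D lo hi (oth du.1) ≤ 2 * (P.r (oth du.1) : ℤ)))
    (hrdB : ∀ du : MDir, ∀ j ≤ (B du).N,
      let lo := dLo du.1 (sgOf du) 0 ((B du).aLo j - (B du).ea - (B du).La) ((B du).aHi j + (B du).ea + (B du).La)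
        ((B du).bLo j - (B du).eb - (B du).Lb) ((B du).bHi j + (B du).eb + (B du).Lb)
      let hi := dHi du.1 (sgOf du) 0 ((B du).aLo j - (B du).ea - (B du).La) ((B du).aHi j + (B du).ea + (B du).La)
        ((B du).bLo j - (B du).eb - (B du).Lb) ((B du).bHi j + (B du).eb + (B du).Lb)
      (sgOf du = 1 → -(5 * (P.r du.1 : ℤ)) ≤ rdLo A n h vα vβ c₀' c₁' D lo hi du.1 ∧ rdHi A n h vα vβ c₀' c₁' D lo hi du.1 ≤ 22 * (P.r du.1 : ℤ)) ∧
      (sgOf du = -1 → -(5 * (P.r du.1 : ℤ)) ≤ -rdHi A n h vα vβ c₀' c₁' D lo hi du.1 ∧ -rdLo A n h vα vβ c₀' c₁' D lo hi du.1 ≤ 22 * (P.r du.1 : ℤ)) ∧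
      (-(2 * (P.r (oth du.1) : ℤ)) ≤ rdLo A n h vα vβ c₀' c₁' D lo hi (oth du.1) ∧
        rdHi A n h vα vβ c₀' c₁' D lo hi (oth du.1) ≤ 2 * (P.r (oth du.1) : ℤ)))
    (hrdL : ∀ du : MDir,
      let lo := dLo du.1 (sgOf du) 0 ((B du).aLo ((B du).N + 1)) ((B du).aHi ((B du).N + 1)) ((B du).bLo ((B du).N + 1)) ((B du).bHi ((B du).N + 1))
      let hi := dHi du.1 (sgOf du) 0 ((B du).aLo ((B du).N + 1)) ((B du).aHi ((B du).N + 1)) ((B du).bLo ((B du).N + 1)) ((B du).bHi ((B du).N + 1))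
      (sgOf du = 1 → 20 * (P.r du.1 : ℤ) - (b₀ du.1 : ℕ) + 1 ≤ rdLo A n h vα vβ c₀' c₁' D lo hi du.1 ∧
        rdHi A n h vα vβ c₀' c₁' D lo hi du.1 ≤ 20 * (P.r du.1 : ℤ) + (b₀ du.1 : ℕ) - 1) ∧
      (sgOf du = -1 → 20 * (P.r du.1 : ℤ) - (b₀ du.1 : ℕ) + 1 ≤ -rdHi A n h vα vβ c₀' c₁' D lo hi du.1 ∧
        -rdLo A n h vα vβ c₀' c₁' D lo hi du.1 ≤ 20 * (P.r du.1 : ℤ) + (b₀ du.1 : ℕ) - 1) ∧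
      (-((b₀ (oth du.1) : ℕ) : ℤ) + 1 ≤ rdLo A n h vα vβ c₀' c₁' D lo hi (oth du.1) ∧ rdHi A n h vα vβ c₀' c₁' D lo hi (oth du.1) ≤ ((b₀ (oth du.1) : ℕ) : ℤ) - 1))
    (hbr : ∀ i, ((b₀ i : ℕ) : ℤ) ≤ 2 * (P.r i : ℤ))
    -- the band's habitat points
    (zB : MDir → ℕ → Site 2) (hzB : ∀ du j, 1 ≤ j → j ≤ (B du).N + 1 → zB du j ∈ (B du).pcore du.1 (sgOf du) 0 j) {Zmax : ℕ}
    (hZ : ∀ du j, ((zB du j) 0).natAbs + ((zB du j) 1).natAbs ≤ Zmax)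
    (hrdZ : ∀ du j,
      (sgOf du = 1 → -(5 * (P.r du.1 : ℤ)) + 1 ≤ rdLo A n h vα vβ c₀' c₁' D (zB du j) (zB du j) du.1 ∧
        rdHi A n h vα vβ c₀' c₁' D (zB du j) (zB du j) du.1 ≤ 22 * (P.r du.1 : ℤ) - 1) ∧
      (sgOf du = -1 → -(5 * (P.r du.1 : ℤ)) + 1 ≤ -rdHi A n h vα vβ c₀' c₁' D (zB du j) (zB du j) du.1 ∧
        -rdLo A n h vα vβ c₀' c₁' D (zB du j) (zB du j) du.1 ≤ 22 * (P.r du.1 : ℤ) - 1) ∧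
      (-(2 * (P.r (oth du.1) : ℤ)) + 1 ≤ rdLo A n h vα vβ c₀' c₁' D (zB du j) (zB du j) (oth du.1) ∧
        rdHi A n h vα vβ c₀' c₁' D (zB du j) (zB du j) (oth du.1) ≤ 2 * (P.r (oth du.1) : ℤ) - 1))
    (hE₀Z : dC + (kq + 3) * Zmax + 3 ≤ E₀)
    {nmax : ℕ} (hlen : ∀ du, PA.N + 1 + (PB.N + 1 + (B du).N) ≤ nmax)
    -- kit constants, count, excess radius
    {Rlev Nk j₀ j₁ : ℕ} (hRl₁ : Rlev + 1 ≤ PA.e) (hRl₂ : Rlev + 1 ≤ PB.e) (hj : j₁ ≤ Rlev)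
    {Δ' : ℕ} {δ η : ℝ} (hcount : 1 / (1 - (q : ℝ)) ^ (Δ' * Nk) ≤ δ * ((Finset.Icc j₀ j₁).card : ℝ)) (hη : η ≤ δ / 2)
    {Rex : ℕ → ℕ}
    (hRex : ∀ R₀' R₁, Rex R₀' ≤ R₁ → ∀ (Rw : ℕ) (D' A' : Finset V), (∀ d ∈ D', d ∈ graphBall G t Rw) →
      (∀ d ∈ D', ∀ d' ∈ D', F d - F d' ∈ box 2 (50 * P.rmax)) → A' ⊆ D' → (∀ a ∈ A', a ∈ graphBall G t R₀') →
        (bondPercolation G q).real (excess G t R₁ D' A') ≤ η)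
    (hsch : ∀ g, Rex (Erad gap gap' E₀ g + 1) + L' ≤ Erad gap gap' E₀ (g + 1)) :
    let Λ := concRadii2N P gap gap' E₀ L' off
    let S : KSchA V ℕ := ⟨cellGeomSG₂b G F P t Λ b₀, q, δc⟩
    let FD := faceDataSG G F P t Λ
    -- the kit clauses of the two segments of the one frame at every run, for the window-chain records whose rims cover the far vertices
    (∀ (ω : BondConfig V) (m : ℕ) (e : Site 2 × MDir),
      (S.astOf₂ G (S.hst₂ G ω m)).st.choice = some e → S.Valid₂ G (S.hst₂ G ω m) e → ∀ du ∈ S.onward G (S.hst₂ G ω m) (tgt e),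
      let Ω := S.Γ.Ewv (S.aOf₁ G (S.hst₂ G ω m) e) e.1 e.2 ∪ FD.Hfull (S.aOf₂ G (S.hst₂ G ω m) e) (tgt e) du
      let S₁f := (PA.scheduleN 1 0 hPA hdL).toFrame
      let hlipR : Lip G (runX φ (cOf (S.aOf₁ G (S.hst₂ G ω m) e) (tgt e)) n h 1) :=
        lip_runX hlipφ (Or.inl rfl) hn (cOf (S.aOf₁ G (S.hst₂ G ω m) e) (tgt e)) h
      ∀ Pd : WinChainData V,
      Pd.o = t → Pd.Sfin = S.Sx G (S.hst₂ G ω m) e (S.aOf₁ G (S.hst₂ G ω m) e) (S.aOf₂ G (S.hst₂ G ω m) e) du →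
      Pd.Rlev = Rlev → Pd.N = Nk → Pd.j₀ = j₀ → Pd.j₁ = j₁ →
      (∀ k, ∀ v ∈ (planarWindowIn hlipR Ω).stepDF S₁f k,
        v ∉ graphBall G t (Erad gap gap' E₀ (nQ (S.aOf₁ G (S.hst₂ G ω m) e) (tgt e)) - L') → v ∈ Pd.Rim k) →
      ∀ k ≤ S₁f.N, ∀ j ∈ Finset.Icc Pd.j₀ Pd.j₁, ∃ (σ : SData V) (Sz : Finset V),
      SHyp (Pd.stepLF (planarWindowIn hlipR Ω) S₁f k) j σ ∧ σ.N ≤ Pd.N ∧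
      (1 - (q : ℝ) ^ σ.sB) ^ σ.k ≤ δ ∧ Sz ⊆ (Pd.stepLF (planarWindowIn hlipR Ω) S₁f k).X j ∧ Sz ⊆ (planarWindowIn hlipR Ω).stepDF S₁f k ∧
      (∀ x ∈ σ.K, ∀ e' ∈ σ.seed x, e' ∉ wireSet (↑Sz : Set V)) ∧ (∀ x ∈ σ.K, σ.face x ⊆ Sz) ∧
      (∀ x ∈ σ.K, 1 - 3 * δ ≤ (prodBernoulli (S.Wcor G FD (S.hst₂ G ω m) e (S.aOf₁ G (S.hst₂ G ω m) e) (S.aOf₂ G (S.hst₂ G ω m) e) du)).real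
        {ω' | ∃ u ∈ σ.face x, 1 - δ < (prodBernoulli (pinW (S.Wcor G FD (S.hst₂ G ω m) e (S.aOf₁ G (S.hst₂ G ω m) e)
          (S.aOf₂ G (S.hst₂ G ω m) e) du) (wireSet (↑Sz : Set V)) ω')).real
          (⋃ t' ∈ Pd.coreEF (planarWindowIn hlipR Ω) S₁f k, openConnIn (↑((planarWindowIn hlipR Ω).stepDF S₁f k) : Set V) u t')})) →
    (∀ (ω : BondConfig V) (m : ℕ) (e : Site 2 × MDir),
      (S.astOf₂ G (S.hst₂ G ω m)).st.choice = some e → S.Valid₂ G (S.hst₂ G ω m) e → ∀ du ∈ S.onward G (S.hst₂ G ω m) (tgt e),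
      let Ω := S.Γ.Ewv (S.aOf₁ G (S.hst₂ G ω m) e) e.1 e.2 ∪ FD.Hfull (S.aOf₂ G (S.hst₂ G ω m) e) (tgt e) du
      let S₂f := (corrRunSchedS PB hPB (B du) du.1 (sgOf_sign du) (hB du) (heb du) (hR' du) (hjoin du) (hreg du)).toFrame
      let hlipR : Lip G (runX φ (cOf (S.aOf₁ G (S.hst₂ G ω m) e) (tgt e)) n h 1) :=
        lip_runX hlipφ (Or.inl rfl) hn (cOf (S.aOf₁ G (S.hst₂ G ω m) e) (tgt e)) h
      ∀ Pd : WinChainData V,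
      Pd.o = t → Pd.Sfin = S.Sx G (S.hst₂ G ω m) e (S.aOf₁ G (S.hst₂ G ω m) e) (S.aOf₂ G (S.hst₂ G ω m) e) du →
      Pd.Rlev = Rlev → Pd.N = Nk → Pd.j₀ = j₀ → Pd.j₁ = j₁ →
      (∀ k, ∀ v ∈ (planarWindowIn hlipR Ω).stepDF S₂f k,
        v ∉ graphBall G t (Erad gap gap' E₀ (nQ (S.aOf₁ G (S.hst₂ G ω m) e) (tgt e)) - L') → v ∈ Pd.Rim k) →
      ∀ k ≤ S₂f.N, ∀ j ∈ Finset.Icc Pd.j₀ Pd.j₁, ∃ (σ : SData V) (Sz : Finset V),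
      SHyp (Pd.stepLF (planarWindowIn hlipR Ω) S₂f k) j σ ∧ σ.N ≤ Pd.N ∧
      (1 - (q : ℝ) ^ σ.sB) ^ σ.k ≤ δ ∧ Sz ⊆ (Pd.stepLF (planarWindowIn hlipR Ω) S₂f k).X j ∧ Sz ⊆ (planarWindowIn hlipR Ω).stepDF S₂f k ∧
      (∀ x ∈ σ.K, ∀ e' ∈ σ.seed x, e' ∉ wireSet (↑Sz : Set V)) ∧ (∀ x ∈ σ.K, σ.face x ⊆ Sz) ∧
      (∀ x ∈ σ.K, 1 - 3 * δ ≤ (prodBernoulli (S.Wcor G FD (S.hst₂ G ω m) e (S.aOf₁ G (S.hst₂ G ω m) e) (S.aOf₂ G (S.hst₂ G ω m) e) du)).real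
        {ω' | ∃ u ∈ σ.face x, 1 - δ < (prodBernoulli (pinW (S.Wcor G FD (S.hst₂ G ω m) e (S.aOf₁ G (S.hst₂ G ω m) e)
          (S.aOf₂ G (S.hst₂ G ω m) e) du) (wireSet (↑Sz : Set V)) ω')).real
          (⋃ t' ∈ Pd.coreEF (planarWindowIn hlipR Ω) S₂f k, openConnIn (↑((planarWindowIn hlipR Ω).stepDF S₂f k) : Set V) u t')})) →
    ReachOblRHN G nmax S FD Δ' δ := by
  intro Λ S FD hkitsR₁ hkitsR₂ hist e hrun hc hV du hdu
  subst hFdef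
  obtain ⟨ω, m, rfl⟩ := hrun
  have hE₀1 : 1 ≤ E₀ := by omega
  -- the twin scheme's rules: re-centring `a ↦ a + 1`, root anchor `0`, root in the origin column
  have hanch : ∀ a v Q, S.Γ.anchor a v Q = a + 1 := fun a v Q => by
    show (cellGeomSG₂b G (fineSkel φ t A n h vα vβ c₀' c₁' s₀ s₁ D) P t Λ b₀).anchor a v Q = a + 1
    rw [cellGeomSG₂b_anchor]; rfl
  have ha₀ : S.Γ.a₀ = 0 := cellGeomSG₂b_a₀ P t Λ b₀
  have hroot0 : S.Γ.root ∈ S.Γ.col 0 := by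
    show (cellGeomSG₂b G (fineSkel φ t A n h vα vβ c₀' c₁' s₀ s₁ D) P t Λ b₀).root ∈
      (cellGeomSG₂b G (fineSkel φ t A n h vα vβ c₀' c₁' s₀ s₁ D) P t Λ b₀).col 0
    rw [cellGeomSG₂b_root, cellGeomSG₂b_col]
    show t ∈ {y : V | fineSkel φ t A n h vα vβ c₀' c₁' s₀ s₁ D y = P.cen 0}
    rw [Set.mem_setOf_eq, PCells2.cen_zero]; exact hF0
  -- the radii at the realised triple
  obtain ⟨hEQ, hBE, hρ, -, hM, hgen⟩ := reach_radii_concN hanch ha₀ hroot0 (P := P) (gap := gap) (gap' := gap') (E₀ := E₀) (L' := L')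
    (off := off) hgap hgapc hoff hE₀1 hc hV hdu
  set α := S.aOf₁ G (S.hst₂ G ω m) e with hαdef
  set β := S.aOf₂ G (S.hst₂ G ω m) e with hβdef
  set y := tgt e with hydef
  set E := Erad gap gap' E₀ (nQ α y) with hEdef
  have hBle : Λ.rB α e.1 e.2 ≤ E := le_of_eq hBE
  have hρle : ∀ ℓ, Λ.ρ β y du ℓ ≤ E := fun ℓ => by rw [hρ ℓ]; exact Nat.sub_le _ _
  -- the onward direction is not the way back
  have hdur : du ≠ rev e.2 := by
    rintro rfl
    obtain ⟨y', hy', hyc⟩ := hV.src_mem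
    have h1 := (Finset.mem_filter.1 hdu).2 y' hy'
    rw [show tgt e + stepVec (rev e.2) = e.1 from tgt_tgt_rev e] at h1
    exact h1 hyc
  -- the depth rooms
  have hl1 : (y 0).natAbs + (y 1).natAbs ≤ nQ α y := l1_tgt_le_nQ hanch ha₀ _ hc
  have hdrift : E₀ + cC * nQ α y ≤ E := Erad_linear gap' E₀ hgapC _
  have hmul : cC * ((y 0).natAbs + (y 1).natAbs) ≤ cC * nQ α y := Nat.mul_le_mul_left _ hl1
  have hZj : ∀ j, (kq + 3) * (((zB du j) 0).natAbs + ((zB du j) 1).natAbs) ≤ (kq + 3) * Zmax := fun j => Nat.mul_le_mul_left _ (hZ du j)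
  have hbase : cC * ((y 0).natAbs + (y 1).natAbs) + dC + (kq + 3) * Zmax + 3 ≤ E := by linarith [hdrift, hmul, hE₀Z]
  have hDQ : ∀ j, cC * ((y 0).natAbs + (y 1).natAbs) + dC + (kq + 3) * (((zB du j) 0).natAbs + ((zB du j) 1).natAbs) + 1 ≤ Λ.rQ α y :=
    fun j => by rw [hEQ]; linarith [hbase, hZj j]
  have hDρ : ∀ j ℓ, cC * ((y 0).natAbs + (y 1).natAbs) + dC + (kq + 3) * (((zB du j) 0).natAbs + ((zB du j) 1).natAbs) + 1 ≤ Λ.ρ β y du ℓ :=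
    fun j ℓ => by rw [hρ ℓ]; exact Nat.le_sub_of_add_le (by linarith [hbase, hZj j])
  have hρM : ∀ ℓ, Λ.ρ β y du ℓ + 1 ≤ Λ.rM β (y + stepVec du) := fun ℓ => by
    rw [hρ ℓ, hM, Frad_succ]
    have := hgapL (Erad gap gap' E₀ (nQ α y))
    omega
  have hRexE : Rex (Erad gap gap' E₀ (nS α e.1) + 1) ≤ E - L' := by
    refine Nat.le_sub_of_add_le ?_
    rw [hEdef, hgen]
    exact hsch _
  -- deep entrances along the run
  have hc' : ((S.scheme₂ G).stN m ω).choice = some e := by rw [S.stN_eq₂]; exact hc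
  have hdeep := deep_of_run₂b hlipF hws P t gap gap' E₀ L' off q δc b₀ hΛ hF0 hgap hgapc hoff hE₀1 hcol ω m hc' hdu β
  -- the records of the twin scheme
  have hL := levelGeomSG₂b P t b₀ hΛ hlipF hb (Λ := Λ)
  have hQ : QSepGeom G S.Γ := qSepGeomSG₂b P t b₀ (Λ := Λ) hlipF
  have hSt := stepsGeomSG₂b P t b₀ hΛ hlipF hws hb (Λ := Λ)
  have hEx := exitGeomSG₂b P t b₀ hΛ hlipF hb (Λ := Λ)
  have hSt₀ := stepsGeomSG₂ P t hΛ hlipF hws (Λ := Λ)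
  -- the habitat (its sets are the old scheme's), the frame at the column vertex
  set Ω := S.Γ.Ewv α e.1 e.2 ∪ FD.Hfull β y du with hΩdef
  have hΩold : Ω = (cellGeomSG₂ G (fineSkel φ t A n h vα vβ c₀' c₁' s₀ s₁ D) P t Λ).Ewv α e.1 e.2 ∪ FD.Hfull β y du := by
    rw [hΩdef]
    show (cellGeomSG₂b G (fineSkel φ t A n h vα vβ c₀' c₁' s₀ s₁ D) P t Λ b₀).Ewv α e.1 e.2 ∪ FD.Hfull β y du = _
    rw [cellGeomSG₂b_Ewv]
  have hanchOld : β ∈ (cellGeomSG₂ G (fineSkel φ t A n h vα vβ c₀' c₁' s₀ s₁ D) P t Λ).anchSet α (tgt e) := by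
    have h' := hV.anch
    change β ∈ (cellGeomSG₂b G (fineSkel φ t A n h vα vβ c₀' c₁' s₀ s₁ D) P t Λ b₀).anchSet α (tgt e) at h'
    rwa [cellGeomSG₂b_anchSet] at h'
  -- the habitat proper of the twin is the old scheme's
  have hQE : ∀ v, v ∈ (cellGeomSG₂ G (fineSkel φ t A n h vα vβ c₀' c₁' s₀ s₁ D) P t Λ).Q α y ∪
      (cellGeomSG₂ G (fineSkel φ t A n h vα vβ c₀' c₁' s₀ s₁ D) P t Λ).Efar β y du → v ∈ S.Γ.Q α y ∪ S.Γ.Efar β y du := by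
    intro v hv
    show v ∈ (cellGeomSG₂b G (fineSkel φ t A n h vα vβ c₀' c₁' s₀ s₁ D) P t Λ b₀).Q α y ∪
      (cellGeomSG₂b G (fineSkel φ t A n h vα vβ c₀' c₁' s₀ s₁ D) P t Λ b₀).Efar β y du
    rw [cellGeomSG₂b_Q, cellGeomSG₂b_Efar]; exact hv
  set c₀ := cOf α y with hc₀def
  have hlipR : Lip G (runX φ c₀ n h 1) := lip_runX hlipφ (Or.inl rfl) hn c₀ h
  set 𝒲 := planarWindowIn hlipR Ω with h𝒲def
  set S₁f := (PA.scheduleN 1 0 hPA hdL).toFrame with hS₁fdef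
  set S₂f := (corrRunSchedS PB hPB (B du) du.1 (sgOf_sign du) (hB du) (heb du) (hR' du) (hjoin du) (hreg du)).toFrame with hS₂fdef
  -- the column vertex lies in the habitat
  have hc₀Ω : c₀ ∈ Ω := by
    rw [hΩold]
    have : c₀ ∈ (cellGeomSG₂ G (fineSkel φ t A n h vα vβ c₀' c₁' s₀ s₁ D) P t Λ).Q α y := hcQ α y
    exact Finset.mem_union_left _ (by rw [CellGeom.Ewv]; exact Finset.mem_union_right _ this)
  -- vertex-level rooms from the reading inequalities
  have hb3 : ∀ i, (fun i => ((b₀ i : ℕ) : ℤ)) i ≤ 3 * (P.r i : ℤ) := fun i => by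
    have := hb i; have : ((b₀ i : ℕ) : ℤ) ≤ ((3 * P.r i : ℕ) : ℤ) := by exact_mod_cast this
    push_cast at this; exact this
  have hroomA : ∀ k ≤ PA.N, ∀ v ∈ Ω, runX φ c₀ n h 1 v ∈ PA.pregion 1 0 k → v ∈ S.Γ.Q α y ∪ S.Γ.Efar β y du := by
    intro k hk v hvΩ hvR
    obtain ⟨h1, h2, h3⟩ := hrdA du k hk
    have hpl := room_Q_union_Hfull_of_rd (s₀ := s₀) (s₁ := s₁) (P := P) (y := y) (du := du) hA.le hn hm.le hc₀'.le hc₁'.le hD (hcF α y) h1 h2 h3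
      (by rw [LocPrmD.pregion] at hvR; exact hvR)
    exact hQE v (mem_Q_union_Efar_of_mem_habΩ₂ hSt₀ hanchOld hdur (by rw [hΩold] at hvΩ; exact hvΩ) hpl)
  have hroom₂ : ∀ k ≤ PB.N, ∀ v ∈ Ω, runX φ c₀ n h 1 v ∈ PB.pregion 0 0 k → v ∈ S.Γ.Q α y ∪ S.Γ.Efar β y du := by
    intro k hk v hvΩ hvR
    have hpl := room₂_of_rd (φ := φ) (t₀ := t) (c₀ := c₀) (s₀ := s₀) (s₁ := s₁) (P := P) (y := y) (du := du) hA.le hn hm.le hc₀'.le hc₁'.le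
      hD (hcF α y) PB (hrd₂ du) k hk v hvR
    exact hQE v (mem_Q_union_Efar_of_mem_habΩ₂ hSt₀ hanchOld hdur (by rw [hΩold] at hvΩ; exact hvΩ) hpl)
  have hroomB : ∀ j ≤ (B du).N, ∀ v ∈ Ω, runX φ c₀ n h 1 v ∈ (B du).pregion du.1 (sgOf du) 0 j → v ∈ S.Γ.Q α y ∪ S.Γ.Efar β y du := by
    intro j hj' v hvΩ hvR
    have hpl := roomB_of_rd (φ := φ) (t₀ := t) (c₀ := c₀) (s₀ := s₀) (s₁ := s₁) (P := P) (y := y) (du := du) hA.le hn hm.le hc₀'.le hc₁'.le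
      hD (hcF α y) (B du) du.1 (sgOf du) (hrdB du) j hj' v hvR
    exact hQE v (mem_Q_union_Efar_of_mem_habΩ₂ hSt₀ hanchOld hdur (by rw [hΩold] at hvΩ; exact hvΩ) hpl)
  have hroomL : ∀ v ∈ Ω, runX φ c₀ n h 1 v ∈ (B du).pcore du.1 (sgOf du) 0 ((B du).N + 1) → v ∈ S.Γ.M β (y + stepVec du) := by
    intro v hvΩ hvR
    obtain ⟨hH, hbox⟩ := roomLb_of_rd (φ := φ) (t₀ := t) (c₀ := c₀) (s₀ := s₀) (s₁ := s₁) (P := P) (y := y) (du := du)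
      (b := fun i => ((b₀ i : ℕ) : ℤ)) hA.le hn hm.le hc₀'.le hc₁'.le hD (hcF α y) (hbr du.1) (by linarith [hbr (oth du.1)])
      (B du) du.1 (sgOf du) (hrdL du) v hvR
    have hv := mem_Mb_of_mem_habΩ₂ (α := α) (a' := β) hlipF hdur hρM hb3 (by rw [hΩold] at hvΩ; exact hvΩ) hH hbox
    show v ∈ (cellGeomSG₂b G (fineSkel φ t A n h vα vβ c₀' c₁' s₀ s₁ D) P t Λ b₀).M β (y + stepVec du)
    rw [cellGeomSG₂b_M, PCells2.Mb_eq_Icc]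
    exact hv
  -- the arrival box's fine footprint about `F c₀ = cen y`
  have hM0f : ∀ v ∈ S.Γ.M α y, |fineSkel φ t A n h vα vβ c₀' c₁' s₀ s₁ D v 0 - fineSkel φ t A n h vα vβ c₀' c₁' s₀ s₁ D c₀ 0| ≤ (b₀ 0 : ℕ) ∧
      |fineSkel φ t A n h vα vβ c₀' c₁' s₀ s₁ D v 1 - fineSkel φ t A n h vα vβ c₀' c₁' s₀ s₁ D c₀ 1| ≤ (b₀ 1 : ℕ) := by
    intro v hv
    have hv' : v ∈ VWin G (fineSkel φ t A n h vα vβ c₀' c₁' s₀ s₁ D) t (P.Mb b₀ y) (Λ.rM α y) := by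
      change v ∈ (cellGeomSG₂b G (fineSkel φ t A n h vα vβ c₀' c₁' s₀ s₁ D) P t Λ b₀).M α y at hv
      rwa [cellGeomSG₂b_M] at hv
    have hpl := (PCells2.mem_Mb_iff P).1 (φ_mem_of_mem_VWin hv')
    rw [hcF α y]
    exact ⟨abs_le.2 ⟨by linarith [(hpl 0).1], by linarith [(hpl 0).2]⟩, abs_le.2 ⟨by linarith [(hpl 1).1], by linarith [(hpl 1).2]⟩⟩
  -- the two window-chain records: rims = far vertices of the regions
  let C₁ : WinChainData V :=
    { Rlev := Rlev, N := Nk, j₀ := j₀, j₁ := j₁, o := t, Sfin := S.Sx G (S.hst₂ G ω m) e α β du,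
      Rim := fun k => (𝒲.stepDF S₁f k).filter fun v => v ∉ graphBall G t (E - L') }
  let C₂ : WinChainData V :=
    { Rlev := Rlev, N := Nk, j₀ := j₀, j₁ := j₁, o := t, Sfin := S.Sx G (S.hst₂ G ω m) e α β du,
      Rim := fun k => (𝒲.stepDF S₂f k).filter fun v => v ∉ graphBall G t (E - L') }
  have hRimD₁ : ∀ k, C₁.Rim k ⊆ 𝒲.stepDF S₁f k := fun k => Finset.filter_subset _ _
  have hRimD₂ : ∀ k, C₂.Rim k ⊆ 𝒲.stepDF S₂f k := fun k => Finset.filter_subset _ _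
  have hRimfar₁ : ∀ k, ∀ v ∈ C₁.Rim k, v ∉ graphBall G t (E - L') := fun k v hv => (Finset.mem_filter.1 hv).2
  have hRimfar₂ : ∀ k, ∀ v ∈ C₂.Rim k, v ∉ graphBall G t (E - L') := fun k v hv => (Finset.mem_filter.1 hv).2
  -- the regions lie in the habitat proper
  have hDΩ : ∀ (Sf : SchedFrame) k, 𝒲.stepDF Sf k ⊆ Ω := fun Sf k v hv => ((mem_WinIn (φ := runX φ c₀ n h 1)).1 hv).1
  have hN₁ : S₁f.N = PA.N := rfl
  have hN₂ : S₂f.N = PB.N + 1 + (B du).N := rfl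
  have hDh₁ : ∀ k ≤ S₁f.N, 𝒲.stepDF S₁f k ⊆ S.Γ.Q α y ∪ S.Γ.Efar β y du := by
    intro k hk v hv
    obtain ⟨hvΩ, hvR⟩ := (mem_WinIn (φ := runX φ c₀ n h 1)).1 hv
    have hvR' : runX φ c₀ n h 1 v ∈ (PA.scheduleN 1 0 hPA hdL).region k := hvR
    rw [LocPrmD.scheduleN_region] at hvR'
    exact hroomA k (by rw [hN₁] at hk; exact hk) v hvΩ hvR'
  have hDh₂ : ∀ k ≤ S₂f.N, 𝒲.stepDF S₂f k ⊆ S.Γ.Q α y ∪ S.Γ.Efar β y du := by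
    intro k hk v hv
    obtain ⟨hvΩ, hvR⟩ := (mem_WinIn (φ := runX φ c₀ n h 1)).1 hv
    have hvR' : runX φ c₀ n h 1 v ∈ (corrRunSchedS PB hPB (B du) du.1 (sgOf_sign du) (hB du) (heb du) (hR' du) (hjoin du) (hreg du)).region k := hvR
    rw [hN₂] at hk
    rcases corrRunSchedS_region_cases PB hPB (B du) du.1 (sgOf_sign du) (hB du) (heb du) (hR' du) (hjoin du) (hreg du) hk with
      ⟨hk', hrg⟩ | ⟨j, hj', -, hrg⟩
    · rw [hrg] at hvR'; exact hroom₂ k hk' v hvΩ hvR'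
    · rw [hrg] at hvR'; exact hroomB j hj' v hvΩ hvR'
  -- the rim excess of the two segments (twin scheme)
  have hexc : ∀ (Sf : SchedFrame) (Rim : ℕ → Finset V), (∀ k, Rim k ⊆ 𝒲.stepDF Sf k) → (∀ k, ∀ v ∈ Rim k, v ∉ graphBall G t (E - L')) →
      ∀ k, 𝒲.stepDF Sf k ⊆ S.Γ.Q α y ∪ S.Γ.Efar β y du →
        (prodBernoulli (S.Wcor G FD (S.hst₂ G ω m) e α β du)).real (⋃ t' ∈ Rim k, openConn t t') ≤ η := by
    intro Sf Rim hRimD hRimfar k hDh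
    exact real_rim_le_concSG₂b hlipF hws hΛ hb hV hV.anch hdu hEQ hBle hρle hdeep (hRex _) hRexE ((hRimD k).trans (hDΩ Sf k))
      ((hRimD k).trans hDh) (hRimfar k)
  have hexc₁ : ∀ k ≤ S₁f.N, (prodBernoulli (S.Wcor G FD (S.hst₂ G ω m) e α β du)).real (⋃ t' ∈ C₁.Rim k, openConn t t') ≤ η :=
    fun k hk => hexc S₁f C₁.Rim hRimD₁ hRimfar₁ k (hDh₁ k hk)
  have hexc₂ : ∀ k ≤ S₂f.N, (prodBernoulli (S.Wcor G FD (S.hst₂ G ω m) e α β du)).real (⋃ t' ∈ C₂.Rim k, openConn t t') ≤ η :=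
    fun k hk => hexc S₂f C₂.Rim hRimD₂ hRimfar₂ k (hDh₂ k hk)
  -- the kit clauses at this run
  have hkits₁ := hkitsR₁ ω m e hc hV du hdu C₁ rfl rfl rfl rfl rfl rfl (fun k v hv hfar => Finset.mem_filter.2 ⟨hv, hfar⟩)
  have hkits₂ := hkitsR₂ ω m e hc hV du hdu C₂ rfl rfl rfl rfl rfl rfl (fun k v hv hfar => Finset.mem_filter.2 ⟨hv, hfar⟩)
  -- the true targets are nonempty: segment A's cores contain `0 = R c₀`; segment B+C as in C-A5
  have hTne₁ : ∀ k ≤ S₁f.N, (𝒲.coreTF S₁f k).Nonempty := by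
    intro k _
    refine coreTF_nonempty_of_mem hlipR hc₀Ω ?_
    show runX φ c₀ n h 1 c₀ ∈ (PA.scheduleN 1 0 hPA hdL).core (k + 1)
    rw [runX_origin, LocPrmD.scheduleN_core, LocPrmD.mem_pcore_iff]
    simp only [Pi.zero_apply, sub_self, abs_zero]
    refine ⟨LocPrm.L_nonneg (LocPrmD.toLoc_ok hPA) _, ?_⟩
    have := abs_nonneg PA.d; positivity
  have hTne₂ : ∀ k ≤ S₂f.N, (𝒲.coreTF S₂f k).Nonempty := by
    intro k hk
    refine coreTF₂_nonempty hlipR hc₀Ω PB hPB (B du) du.1 (sgOf_sign du) (hB du) (heb du) (hR' du) (hjoin du) (hreg du) ?_ hk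
    intro j hj1 hjN
    obtain ⟨h1, h2, h3⟩ := hrdZ du j
    obtain ⟨g, hg, hgz⟩ := exists_mem_span_runX_eq (s₀ := s₀) (s₁ := s₁) (P := P) (Λ := Λ) (α := α) (a' := β) (y := y) (du := du)
      hstep hA.le hn hm.le hc₀'.le hc₁'.le hD hκ hlipF hws (hcF α y) (hcD α y) (zB du j) (hDQ j) (hDρ j) h1 h2 h3
    exact ⟨g, by rw [hΩold]; exact Q_union_HfullSpan_subset_habΩ₂ hg, by rw [hgz]; exact hzB du j hj1 hjN⟩
  -- assemble
  exact reachOblAtHN_negCorridor1 hA hn hm hc₀' hc₁' hD _ rfl c₀ (runX φ c₀ n h 1) rfl hlipR hL hQ hSt hEx hV hV.anch hdu Ω rfl hM0f ha hBx hb'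
    PA hPA hdL haW hbL PB hPB (B du) du.1 (sgOf_sign du) (hB du) (heb du) (hR' du) (hjoin du) (hreg du) hjoinA hroomA hroom₂ hroomB hroomL (hlen du)
    S₁f S₂f rfl rfl C₁ C₂ rfl rfl rfl rfl hRimD₁ hRimD₂ (by show Rlev + 1 ≤ PA.e; exact hRl₁) (by show Rlev + 1 ≤ PB.e; exact hRl₂) hj hj hTne₁ hTne₂
    hcount hcount hkits₁ hkits₂ hη hexc₁ hexc₂

end Skelφ

end Transplant

end Summit.CriticalPhenomena.PercolationContinuityZ3.Theorems

end
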